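import Literature.AlgebraicGeometry.Resolution.GRingPolynomialKernelGeneric
import Literature.AlgebraicGeometry.Resolution.RegularFibreByDerivation
import Mathlib.RingTheory.KrullDimension.PID
import Mathlib.RingTheory.Localization.Algebra
import Mathlib.FieldTheory.Separable
import Mathlib.Algebra.Polynomial.Derivation
import HarnessLib

/-!
# Grothendieck's theorem on G-rings (Stacks 07PV), the kernel in characteristic zero:
# fibres over the primes `𝔯 ≠ 0` with `𝔯 ∩ A = 0`

Topic: `Literature/AlgebraicGeometry/Resolution`. Continues `GRingPolynomialKernelGeneric.lean`
(the case `𝔯 = 0`). Here: for a regular local ring `A` whose fraction field `K` has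
characteristic zero, a prime `Q` of `A[x]` and a prime `0 ≠ 𝔯 ⊆ Q` with `𝔯 ∩ A = 0`, the formal
fibre of `A[x]_Q` over `𝔯` is geometrically regular — the case of The Stacks Project, Tag 07PV,
that its text subsumes under "Thus we are done if the characteristic of the fraction field of `R`
is `0`", proved here by the argument of Tag 07PU (Lemma 15.51.9) in its characteristic-zero form:
`𝔯K[x] = (g)` with `g` irreducible, hence separable, so `a g + b g' = c` with `c ∈ A ∖ 0`; the
derivation `d/dx` extends to `A[x]_Q` and to its completion `Ŝ` (Stacks 07PE), `Ŝ` is regular, and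
`RegularFibreByDerivation.lean` (Matsumura Thm. 30.4 (ii)) shows that the fibre ring
`κ(𝔯) ⊗ Ŝ` is regular, hence geometrically regular (`char κ(𝔯) = 0`). Everything is PROVED; no
new notions, no named facts.

## Content (namespace `Literature.AlgebraicGeometry.Resolution`)

* `exists_mem_bezout_derivative_of_charZero` — for a domain `A` of characteristic zero and a
  prime `𝔯 ≠ 0` of `A[x]` with `𝔯 ∩ A = 0`: `ht 𝔯 = 1` and there are `g ∈ 𝔯`, `a, b ∈ A[x]`,
  `c ∈ A ∖ 0` with `a g + b g' = c`.
* `hasGeomRegularGenericFormalFibre_quotient_of_fibre` — translation: geometric regularity of the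
  fibre of `T_Q → (T_Q)^` over `𝔯T_Q` gives the generic formal fibre of `(T/𝔯)_{Q/𝔯}`
  (Stacks 07PN, `isGeometricallyRegular_fibre_completion_of_surjective`).
* `hasGeomRegularGenericFormalFibre_polynomial_quotient_of_charZero` — the kernel `hker` of
  `GRingPolynomialCoreReduction.lean` for `A` (regular local) of characteristic zero, all `𝔯`.

## Sources

* The Stacks Project, Tag 07PV (proof) and Tag 07PU (Lemma 15.51.9, proof: "`𝔯K[x]` is
  generated by `x - f` … The derivation `D = d/dx` … We conclude by Lemma 15.49.2"); Tags 07PE,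
  07PN. [StacksProject]
* H. Matsumura, *Commutative Ring Theory*, CUP 1986, Thm. 30.4 (ii). [Matsumura1987]
-/

noncomputable section

open IsLocalRing Polynomial TensorProduct

namespace Literature.AlgebraicGeometry.Resolution

universe u

/-! ## `𝔯K[x] = (g)` with `g` separable: a Bézout identity with cleared denominators -/

/-- For a domain `A` of characteristic zero with fraction field `K` and a prime `𝔯 ≠ 0` of `A[x]`
with `𝔯 ∩ A = 0`: `ht 𝔯 = 1`, and there are `g ∈ 𝔯`, `a, b ∈ A[x]` and `c ∈ A ∖ 0` with
`a g + b g' = c`. (`𝔯K[x]` is a nonzero prime of the principal ideal domain `K[x]`, generated by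
an irreducible, hence separable, `g₀`; write the Bézout identity `a₀ g₀ + b₀ g₀' = 1` over `A[x]`
by clearing denominators.) [cite: StacksProject, Tag 07PU (proof)] -/
theorem exists_mem_bezout_derivative_of_charZero (A : Type u) [CommRing A] [IsDomain A]
    [IsNoetherianRing A] [CharZero A] (r : Ideal A[X]) [r.IsPrime] (hr0 : r ≠ ⊥)
    (hrA : r.under A = ⊥) :
    r.height = 1 ∧ ∃ g ∈ r, ∃ (a b : A[X]) (c : A), c ≠ 0 ∧
      a * g + b * derivative g = Polynomial.C c := by
  classical
  set K := FractionRing A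
  letI : Algebra A[X] K[X] := Polynomial.algebra A K
  set M : Submonoid A[X] := (nonZeroDivisors A).map (Polynomial.C : A →+* A[X]) with hM
  haveI : IsLocalization M K[X] := Polynomial.isLocalization (nonZeroDivisors A) K
  have halg : ∀ f : A[X], algebraMap A[X] K[X] f = f.map (algebraMap A K) := fun f => rfl
  -- `𝔯` misses `M`
  have hmemM : ∀ {m : A[X]}, m ∈ M → ∃ s : A, s ≠ 0 ∧ Polynomial.C s = m := fun hm => by
    obtain ⟨s, hs, rfl⟩ := Submonoid.mem_map.mp hm
    exact ⟨s, nonZeroDivisors.ne_zero hs, rfl⟩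
  have hCr : ∀ {s : A}, Polynomial.C s ∈ r → s = 0 := fun {s} hs => by
    have h : s ∈ r.under A := by
      rw [Ideal.under_def, Ideal.mem_comap, Polynomial.algebraMap_apply, Algebra.algebraMap_self,
        RingHom.id_apply]
      exact hs
    rw [hrA] at h
    exact (Submodule.mem_bot A).mp h
  have hdisj : Disjoint (M : Set A[X]) (r : Set A[X]) := by
    rw [Set.disjoint_left]
    intro m hm hmr
    obtain ⟨s, hs, rfl⟩ := hmemM hm
    exact hs (hCr hmr)
  have hMle : M ≤ nonZeroDivisors A[X] := fun m hm => by
    obtain ⟨s, hs, rfl⟩ := hmemM hm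
    exact mem_nonZeroDivisors_of_ne_zero (Polynomial.C_ne_zero.mpr hs)
  have hinj : Function.Injective (algebraMap A[X] K[X]) := IsLocalization.injective K[X] hMle
  -- `𝔯K[x]`, a nonzero prime of `K[x]`
  set rK : Ideal K[X] := r.map (algebraMap A[X] K[X]) with hrK
  haveI : rK.IsPrime := IsLocalization.isPrime_of_isPrime_disjoint M K[X] r ‹_› hdisj
  have hrKr : rK.comap (algebraMap A[X] K[X]) = r := by
    rw [← Ideal.under_def]
    exact IsLocalization.under_map_of_isPrime_disjoint M K[X] ‹r.IsPrime› hdisj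
  have hrK0 : rK ≠ ⊥ := fun h => hr0 (by rw [← hrKr, h, Ideal.comap_bot_of_injective _ hinj])
  -- `ht 𝔯 = ht 𝔯K[x] = 1`
  have hhtK : rK.height = 1 := by
    apply le_antisymm
    · have h1 : (rK.height : WithBot ℕ∞) ≤ ringKrullDim K[X] := Ideal.height_le_ringKrullDim_of_isPrime
      rw [IsPrincipalIdealRing.ringKrullDim_eq_one K[X] (Polynomial.not_isField K)] at h1
      exact_mod_cast h1
    · rw [Order.one_le_iff_ne_zero]
      intro h0
      exact hrK0 (Ideal.height_eq_zero_iff_eq_bot.mp h0)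
  have hht : r.height = 1 := by
    rw [← IsLocalization.height_map_of_disjoint (S := K[X]) M r hdisj]
    exact hhtK
  refine ⟨hht, ?_⟩
  -- a separable generator `g₀` of `𝔯K[x]` and a Bézout identity
  set g₀ : K[X] := Submodule.IsPrincipal.generator rK with hg₀def
  have hg₀ : rK = Ideal.span {g₀} := (Ideal.span_singleton_generator rK).symm
  have hg₀0 : g₀ ≠ 0 := fun h => hrK0 (by rw [hg₀, h, Ideal.span_singleton_eq_bot])
  have hg₀prime : Prime g₀ := (Ideal.span_singleton_prime hg₀0).mp (hg₀ ▸ ‹rK.IsPrime›)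
  obtain ⟨a₀, b₀, hab⟩ := (hg₀prime.irreducible.separable : IsCoprime g₀ (derivative g₀))
  -- clear denominators: `g₀ C(s) = g`, `a₀ C(s₁) = a`, `b₀ C(s₂) = b`
  obtain ⟨⟨g, mg⟩, hg⟩ := IsLocalization.surj M g₀
  obtain ⟨⟨a, ma⟩, ha⟩ := IsLocalization.surj M a₀
  obtain ⟨⟨b, mb⟩, hb⟩ := IsLocalization.surj M b₀
  obtain ⟨s, hs, hsg⟩ := hmemM mg.2
  obtain ⟨s₁, hs₁, hs₁a⟩ := hmemM ma.2
  obtain ⟨s₂, hs₂, hs₂b⟩ := hmemM mb.2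
  simp only at hg ha hb
  -- `g ∈ 𝔯`
  have hgr : g ∈ r := by
    rw [← hrKr, Ideal.mem_comap, ← hg]
    exact Ideal.mul_mem_right _ _ (hg₀ ▸ Ideal.mem_span_singleton_self g₀)
  refine ⟨g, hgr, a * Polynomial.C s₂, b * Polynomial.C s₁, s * s₁ * s₂,
    mul_ne_zero (mul_ne_zero hs hs₁) hs₂, hinj ?_⟩
  -- the identity holds in `K[x]`
  have hφC : ∀ t : A, algebraMap A[X] K[X] (Polynomial.C t) = Polynomial.C (algebraMap A K t) :=
    fun t => by rw [halg, Polynomial.map_C]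
  have hCs : algebraMap A[X] K[X] (mg : A[X]) = Polynomial.C (algebraMap A K s) := by
    rw [← hsg, hφC]
  have hCs₁ : algebraMap A[X] K[X] (ma : A[X]) = Polynomial.C (algebraMap A K s₁) := by
    rw [← hs₁a, hφC]
  have hCs₂ : algebraMap A[X] K[X] (mb : A[X]) = Polynomial.C (algebraMap A K s₂) := by
    rw [← hs₂b, hφC]
  rw [hCs] at hg
  rw [hCs₁] at ha
  rw [hCs₂] at hb
  have hdg : algebraMap A[X] K[X] (derivative g) =
      derivative g₀ * Polynomial.C (algebraMap A K s) := by
    rw [halg, ← Polynomial.derivative_map, ← halg, ← hg, Polynomial.derivative_mul,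
      Polynomial.derivative_C, mul_zero, add_zero]
  simp only [map_add, map_mul, hφC]
  rw [← hg, ← ha, ← hb, hdg]
  linear_combination
    (Polynomial.C (algebraMap A K s) * Polynomial.C (algebraMap A K s₁) *
      Polynomial.C (algebraMap A K s₂)) * hab

/-! ## Translation: from the fibre of `T_Q → (T_Q)^` over `𝔯T_Q` to the generic formal fibre of `T/𝔯` -/

/-- Geometric regularity of a fibre is insensitive to rewriting the prime (the residue field is
a dependent type). [folklore] -/
theorem isGeometricallyRegular_fibre_of_eq {R M : Type u} [CommRing R] [CommRing M] [Algebra R M]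
    {I J : Ideal R} [I.IsPrime] [J.IsPrime] (h : I = J)
    (H : IsGeometricallyRegular I.ResidueField (I.Fiber M)) :
    IsGeometricallyRegular J.ResidueField (J.Fiber M) := by
  subst h
  exact H

/-- **Stacks 07PN, the direction "fibre over `𝔯` ⇒ generic formal fibre of the quotient"**: for
a Noetherian ring `T`, a prime `Q`, a prime `𝔭` of `R = T_Q` with `𝔯 = 𝔭 ∩ T`, and the prime
`𝔫 = Q/𝔯` of `T/𝔯`: if the fibre of `R → R^` over `𝔭` is geometrically regular, then the generic
formal fibre of `(T/𝔯)_𝔫 = R/𝔭` is geometrically regular (`R → (T/𝔯)_𝔫` is onto with kernel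
`𝔭`; fibre transport `isGeometricallyRegular_fibre_completion_of_surjective`).
[cite: StacksProject, Tag 07PN] -/
theorem hasGeomRegularGenericFormalFibre_quotient_of_fibre {T : Type u} [CommRing T]
    [IsNoetherianRing T] (Q : Ideal T) [Q.IsPrime] (p : Ideal (Localization.AtPrime Q))
    [p.IsPrime] (r : Ideal T) [r.IsPrime]
    (hpr : p.comap (algebraMap T (Localization.AtPrime Q)) = r)
    (H : IsGeometricallyRegular p.ResidueField
      (p.Fiber (AdicCompletion (maximalIdeal (Localization.AtPrime Q)) (Localization.AtPrime Q))))
    (n : Ideal (T ⧸ r)) [n.IsPrime] (hn : Q = n.comap (Ideal.Quotient.mk r)) :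
    HasGeomRegularGenericFormalFibre (T ⧸ r) n := by
  intro p' _ hp'0
  obtain rfl := eq_bot_of_comap_eq_bot_localizationAtPrime (T ⧸ r) n p' hp'0
  set R := Localization.AtPrime Q
  set R' := Localization.AtPrime n
  haveI : IsNoetherianRing R := IsLocalization.isNoetherianRing Q.primeCompl R inferInstance
  haveI : IsNoetherianRing R' := IsLocalization.isNoetherianRing n.primeCompl R' inferInstance
  let φ := Localization.localRingHom Q n (Ideal.Quotient.mk r) hn
  letI : Algebra R R' := φ.toAlgebra
  have hφ : Function.Surjective (algebraMap R R') := localRingHom_quotient_surjective Q r n hn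
  have hinj : Function.Injective (algebraMap (T ⧸ r) R') :=
    IsLocalization.injective R' n.primeCompl_le_nonZeroDivisors
  have hcomp : φ.comp (algebraMap T R) = (algebraMap (T ⧸ r) R').comp (Ideal.Quotient.mk r) :=
    RingHom.ext fun a => Localization.localRingHom_to_map Q n (Ideal.Quotient.mk r) hn a
  have hbot : ((⊥ : Ideal R').comap φ).comap (algebraMap T R) = r := by
    rw [Ideal.comap_comap, hcomp, ← Ideal.comap_comap, Ideal.comap_bot_of_injective _ hinj,
      ← RingHom.ker_eq_comap_bot, Ideal.mk_ker]
  have hp' : p = (⊥ : Ideal R').comap (algebraMap R R') := by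
    calc p = (p.comap (algebraMap T R)).map (algebraMap T R) := by
          rw [← Ideal.under_def]; exact (IsLocalization.map_under Q.primeCompl R p).symm
      _ = (((⊥ : Ideal R').comap φ).comap (algebraMap T R)).map (algebraMap T R) := by
          rw [hbot, hpr]
      _ = (⊥ : Ideal R').comap φ := by
          rw [← Ideal.under_def]; exact IsLocalization.map_under Q.primeCompl R _
  exact isGeometricallyRegular_fibre_completion_of_surjective hφ ⊥
    (isGeometricallyRegular_fibre_of_eq hp' H)

/-! ## The fibres over `𝔯 ≠ 0` in characteristic zero -/

/-- **Stacks 07PV, the case `𝔯 ≠ 0`, `𝔯 ∩ A = 0`, in characteristic zero** (by the argument of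
07PU): for a regular local ring `A` of characteristic zero, a prime `Q` of `A[x]`, a prime
`0 ≠ 𝔯 ⊆ Q` with `𝔯 ∩ A = 0` and the prime `𝔭 = 𝔯A[x]_Q`, the fibre of `A[x]_Q → (A[x]_Q)^`
over `𝔭` is geometrically regular: with `a g + b g' = c` (`exists_mem_bezout_derivative_of_charZero`)
and the extension `D` of `d/dx` to `Ŝ = (A[x]_Q)^` (Stacks 07PE), `b · D(g) ≡ c (mod g)`, `Ŝ` is
a regular ring, so the fibre ring `κ(𝔭) ⊗ Ŝ` is regular (`isRegularRing_fiber_of_derivation`),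
and `char κ(𝔭) = 0`. [cite: StacksProject, Tag 07PV (proof)] -/
theorem isGeometricallyRegular_fibre_polynomial_of_charZero (A : Type u) [CommRing A]
    [IsRegularLocalRing A] [CharZero A] (Q : Ideal A[X]) [Q.IsPrime] (r : Ideal A[X]) [r.IsPrime]
    (hr0 : r ≠ ⊥) (hrA : r.under A = ⊥) (p : Ideal (Localization.AtPrime Q)) [p.IsPrime]
    (hpr : p.comap (algebraMap A[X] (Localization.AtPrime Q)) = r) :
    IsGeometricallyRegular p.ResidueField
      (p.Fiber (AdicCompletion (maximalIdeal (Localization.AtPrime Q)) (Localization.AtPrime Q))) := by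
  haveI : IsDomain A := isDomain_of_isRegularLocalRing A
  haveI : IsRegularRing A := isRegularRing_of_isRegularLocalRing A
  haveI : IsNoetherianRing (Localization.AtPrime Q) :=
    IsLocalization.isNoetherianRing Q.primeCompl _ inferInstance
  haveI : IsRegularLocalRing (Localization.AtPrime Q) :=
    IsRegularRing.isRegularLocalRing_localization Q
  haveI : IsRegularRing (AdicCompletion (maximalIdeal (Localization.AtPrime Q)) (Localization.AtPrime Q)) :=
    isRegularRing_adicCompletion (Localization.AtPrime Q)
  haveI : IsNoetherianRing (AdicCompletion (maximalIdeal (Localization.AtPrime Q)) (Localization.AtPrime Q)) :=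
    isNoetherianRing_adicCompletion_maximalIdeal (Localization.AtPrime Q)
  haveI : IsScalarTower A[X] (Localization.AtPrime Q) (AdicCompletion (maximalIdeal (Localization.AtPrime Q)) (Localization.AtPrime Q)) :=
    IsScalarTower.of_algebraMap_eq (R := A[X]) (S := Localization.AtPrime Q)
      (A := AdicCompletion (maximalIdeal (Localization.AtPrime Q)) (Localization.AtPrime Q)) fun _ => rfl
  haveI : Module.Flat A[X] (Localization.AtPrime Q) := IsLocalization.flat _ Q.primeCompl
  haveI : Module.Flat (Localization.AtPrime Q) (AdicCompletion (maximalIdeal (Localization.AtPrime Q)) (Localization.AtPrime Q)) :=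
    AdicCompletion.flat_of_isNoetherian _
  haveI : Module.Flat A[X] (AdicCompletion (maximalIdeal (Localization.AtPrime Q)) (Localization.AtPrime Q)) :=
    Module.Flat.trans A[X] (Localization.AtPrime Q) _
  -- `a g + b g' = c` with `g ∈ 𝔯`, `c ∈ A ∖ 0`, and `ht 𝔯 = 1`
  obtain ⟨hht, g, hgr, a, b, c, hc, habc⟩ := exists_mem_bezout_derivative_of_charZero A r hr0 hrA
  -- `d/dx` extends to `(Localization.AtPrime Q)` and to `Ŝ`
  obtain ⟨DR, hDR⟩ := exists_derivation_extend_of_isLocalization A (Localization.AtPrime Q) Q.primeCompl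
    (Polynomial.derivative' : Derivation A A[X] A[X])
  obtain ⟨DR', hDR'⟩ := exists_derivation_int_of_leibniz DR.toLinearMap.toAddMonoidHom
    fun x y => by
      change DR (x * y) = x * DR y + y * DR x
      rw [Derivation.leibniz, smul_eq_mul, smul_eq_mul]
  obtain ⟨DSh, hDSh₀⟩ := exists_derivation_adicCompletion_extend (maximalIdeal (Localization.AtPrime Q)) DR'
  have hDSh : ∀ t : A[X], DSh (algebraMap A[X] (AdicCompletion (maximalIdeal (Localization.AtPrime Q)) (Localization.AtPrime Q)) t) = algebraMap A[X] (AdicCompletion (maximalIdeal (Localization.AtPrime Q)) (Localization.AtPrime Q)) (derivative t) := by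
    intro t
    rw [IsScalarTower.algebraMap_apply A[X] (Localization.AtPrime Q) (AdicCompletion (maximalIdeal (Localization.AtPrime Q)) (Localization.AtPrime Q)) t, hDSh₀,
      IsScalarTower.algebraMap_apply A[X] (Localization.AtPrime Q) (AdicCompletion (maximalIdeal (Localization.AtPrime Q)) (Localization.AtPrime Q)) (derivative t), hDR']
    change algebraMap (Localization.AtPrime Q) (AdicCompletion (maximalIdeal (Localization.AtPrime Q)) (Localization.AtPrime Q)) (DR (algebraMap A[X] (Localization.AtPrime Q) t)) = _
    rw [hDR]
    rfl
  -- `b · D(g) - c = -a · g`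
  have hD : ∃ (v : (AdicCompletion (maximalIdeal (Localization.AtPrime Q)) (Localization.AtPrime Q))) (c' : A[X]), c' ∉ r ∧
      v * DSh (algebraMap A[X] (AdicCompletion (maximalIdeal (Localization.AtPrime Q)) (Localization.AtPrime Q)) g) - algebraMap A[X] (AdicCompletion (maximalIdeal (Localization.AtPrime Q)) (Localization.AtPrime Q)) c' ∈ Ideal.span {algebraMap A[X] (AdicCompletion (maximalIdeal (Localization.AtPrime Q)) (Localization.AtPrime Q)) g} := by
    refine ⟨algebraMap A[X] (AdicCompletion (maximalIdeal (Localization.AtPrime Q)) (Localization.AtPrime Q)) b, Polynomial.C c, fun h => hc ?_, ?_⟩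
    · have h1 : c ∈ r.under A := by
        rw [Ideal.under_def, Ideal.mem_comap, Polynomial.algebraMap_apply, Algebra.algebraMap_self,
          RingHom.id_apply]
        exact h
      rw [hrA] at h1
      exact (Submodule.mem_bot A).mp h1
    · rw [hDSh, ← map_mul, ← map_sub, Ideal.mem_span_singleton]
      refine ⟨algebraMap A[X] (AdicCompletion (maximalIdeal (Localization.AtPrime Q)) (Localization.AtPrime Q)) (-a), ?_⟩
      rw [← map_mul]
      congr 1
      linear_combination habc
  -- the fibre ring is regular (Matsumura Thm. 30.4 (ii)), hence geometrically regular (char 0)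
  haveI : IsRegularRing (p.Fiber (AdicCompletion (maximalIdeal (Localization.AtPrime Q)) (Localization.AtPrime Q))) :=
    isRegularRing_fiber_of_derivation Q (AdicCompletion (maximalIdeal (Localization.AtPrime Q)) (Localization.AtPrime Q)) r hht g hgr DSh hD p hpr
      fun 𝔔 _ _ => IsRegularRing.isRegularLocalRing_localization 𝔔
  haveI : CharZero p.ResidueField := by
    refine charZero_of_injective_ringHom (f := (algebraMap (Localization.AtPrime Q) p.ResidueField).comp (algebraMap A (Localization.AtPrime Q))) ?_
    rw [injective_iff_map_eq_zero]
    intro x hx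
    rw [RingHom.comp_apply, Ideal.algebraMap_residueField_eq_zero] at hx
    have h1 : Polynomial.C x ∈ r := by
      rw [← hpr, Ideal.mem_comap]
      rwa [IsScalarTower.algebraMap_apply A A[X] (Localization.AtPrime Q), Polynomial.algebraMap_apply, Algebra.algebraMap_self,
        RingHom.id_apply] at hx
    have h2 : x ∈ r.under A := by
      rw [Ideal.under_def, Ideal.mem_comap, Polynomial.algebraMap_apply, Algebra.algebraMap_self,
        RingHom.id_apply]
      exact h1
    rw [hrA] at h2
    exact (Submodule.mem_bot A).mp h2
  exact isGeometricallyRegular_of_isRegularRing_of_charZero p.ResidueField (p.Fiber (AdicCompletion (maximalIdeal (Localization.AtPrime Q)) (Localization.AtPrime Q)))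

/-- **The kernel `hker` of `GRingPolynomialCoreReduction.lean` in characteristic zero**: for a
regular local ring `A` of characteristic zero, every prime `𝔯` of `A[x]` with `𝔯 ∩ A = 0` and
every prime `𝔫` of `A[x]/𝔯`, the generic formal fibre of `(A[x]/𝔯)_𝔫` is geometrically
regular (`𝔯 = 0`: `GRingPolynomialKernelGeneric.lean`; `𝔯 ≠ 0`: the previous theorem and the
translation). [cite: StacksProject, Tag 07PV (proof)] -/
theorem hasGeomRegularGenericFormalFibre_polynomial_quotient_of_charZero (A : Type u)
    [CommRing A] [IsRegularLocalRing A] [CharZero A] (r : Ideal A[X]) [r.IsPrime]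
    (hrA : r.under A = ⊥) (n : Ideal (A[X] ⧸ r)) [n.IsPrime] :
    HasGeomRegularGenericFormalFibre (A[X] ⧸ r) n := by
  by_cases hr0 : r = ⊥
  · subst hr0
    exact hasGeomRegularGenericFormalFibre_polynomial_quotient_bot_of_charZero A n
  · set Q : Ideal A[X] := n.comap (Ideal.Quotient.mk r) with hQ
    haveI : Q.IsPrime := Ideal.comap_isPrime _ n
    have hrQ : r ≤ Q := fun x hx => by
      rw [hQ, Ideal.mem_comap, Ideal.Quotient.eq_zero_iff_mem.mpr hx]
      exact n.zero_mem
    have hdisj : Disjoint (Q.primeCompl : Set A[X]) (r : Set A[X]) := by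
      rw [Set.disjoint_left]
      exact fun x hx hxr => hx (hrQ hxr)
    set p : Ideal (Localization.AtPrime Q) := r.map (algebraMap A[X] (Localization.AtPrime Q))
    haveI : p.IsPrime :=
      IsLocalization.isPrime_of_isPrime_disjoint Q.primeCompl (Localization.AtPrime Q) r ‹_› hdisj
    have hpr : p.comap (algebraMap A[X] (Localization.AtPrime Q)) = r := by
      rw [← Ideal.under_def]
      exact IsLocalization.under_map_of_isPrime_disjoint Q.primeCompl _ ‹r.IsPrime› hdisj
    exact hasGeomRegularGenericFormalFibre_quotient_of_fibre Q p r hpr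
      (isGeometricallyRegular_fibre_polynomial_of_charZero A Q r hr0 hrA p hpr) n hQ

end Literature.AlgebraicGeometry.Resolution

end
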